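import Summits.BirchSwinnertonDyer.BirchSwinnertonDyer.Theorems.AdditiveKolyvaginRoadLagrangianSwitchAtPGeneralBase
import HarnessLib

/-!
# Route `AdditiveKolyvaginRoad`, crux KS′ `LevelKolyvaginSystemsAdditive` (stmt-BirchSwinnertonDyer-21396) ∕ KPA′ (stmt-BirchSwinnertonDyer-21400):
# the one-place Lagrangian switch, part 8 — THE SWITCH FOR A GENERAL BASE and THE DOUBLE SWITCH at two plane places: the `p`-Selmer order moves
# by `p²`, `1` or `p⁻²`, so its `𝔽_p`-dimension keeps its PARITY (the parity leg of the «FL-engine», card `irred-vertex-anchor` T2, modulo E's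
# `p`-Selmer parity)
# (cell `pub/bsd-wall`, width seat `bsd-wall-akr-p2x-w3` g10; `--supports stmt-BirchSwinnertonDyer-21396`, helper; E-side glue; sequel of
# `…LagrangianSwitchAtPGeneralBase.lean`)

WHY. See part 7. With the jump, the reciprocity and the Lagrangian-line lemma for a base `𝓑` that is Kummer off `U` and Lagrangian on `U`, the
landed switch argument runs verbatim at a plane place `w₀ ∉ U`; two switches at distinct plane places `w₁, w₂` (the places above a split `p` of the
Heegner field) then compose, the second with base `𝓚[w₁ ↦ L₁]`, `U = {w₁}`. Each switch moves the Selmer order by EXACTLY one factor `p` (up or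
down), so after two the `𝔽_p`-dimension has the same parity as E's `p`-Selmer dimension: with this seat's `exists_level_switched_eq_bot_at_p`
(`#n₀ = dim Sw(+) + dim Sw(−)`), `finrank_switched_empty_eq_eigen_add` (`= dim D`, `Λ` c-stable) and `switchedTotal_eq_selmerGroup`
(`D = H¹_{𝓚[𝔭 ↦ L][𝔭̄ ↦ L̄]}`), the level `n₀` of the switched descent is ODD exactly when E's `p`-Selmer dimension over `K` is — stub P of 21400
(PUB-shaped: Gross–Zagier–Kolyvagin + Cassels–Tate, or `p`-parity). That is the whole E-side of the card's T2.

WHAT (namespace `…Theorems.AdditiveKoly.LagrangianSwitchAtP`).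
* §5 **`natCard_selmerGroup_switch_of_base`** — `𝓑` Kummer off `U`, Lagrangian on `U`; `w₀ ∉ U` a plane; `L` isotropic, `≠ 0`, `≠ 𝓚_{w₀}` ⟹
  `#H¹_𝓑 = p · #H¹_{𝓑[w₀ ↦ L]}` or `#H¹_{𝓑[w₀ ↦ L]} = p · #H¹_𝓑` (proof = the landed one with part 7's jump ∕ reciprocity).
* §6 **`natCard_selmerGroup_double_switch_of_poitouTate`** — `p ≠ 2`, the Poitou–Tate fact (a tree theorem at any call site), planes `w₁ ≠ w₂`,
  `L_i` isotropic for every family ∕ pairing, `≠ 0`, `≠ 𝓚_{w_i}` ⟹ `N₀ = p² N₂ ∨ N₀ = N₂ ∨ N₂ = p² N₀` for `N₀ = #H¹_𝓚`, `N₂ = #H¹_{𝓚[w₁ ↦ L₁][w₂ ↦ L₂]}`;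
  `exists_pow_and_even_iff_of_double_switch` — hence `N₀ = p^a ⟹ N₂ = p^b` with `a ≡ b (mod 2)`.

HONEST FRAMING: theorems only; 0 definitions, 0 named facts, 0 `sorry`; standard axioms; hypotheses displayed (plane counts at `w₁, w₂`: for the
places above a split `p ≥ 3` they follow from `E(K_𝔭)[p] = 0`, `natCard_localH1_eq_sq`; the MIXED case `L₁ = 𝓚_{w₁}, L₂ ≠ 𝓚_{w₂}` flips the parity and
is excluded by hypothesis). E-side glue; closes nothing; the companion side of the card (T1 ∕ T3 ∕ T4 ∕ T5) and E's `p`-Selmer parity are untouched.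
BSD is not proved by any of this.

References: [cite: PoonenRains2012, Prop. 4.10, Prop. 4.11] [cite: MilneADT2006, Ch. I, Cor. 2.3, Thm. 2.8, Thm. 4.10] [cite: McCallumLMS1991, Prop. 2.1].
-/

-- single-conjunct summit: `Summit.BirchSwinnertonDyer.BirchSwinnertonDyer.…` repeats the name by design
set_option linter.dupNamespace false

noncomputable section

open scoped Classical NumberField
open Function NumberField IsDedekindDomain Field WeierstrassCurve
open Literature.NumberTheory.EllipticCurves
open Literature.NumberTheory.GaloisRepresentations Literature.NumberTheory.GaloisRepresentations.DiscreteGaloisModule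
  Literature.NumberTheory.GaloisCohomology
open Summit.BirchSwinnertonDyer.Rank1Residual.X11b.FiniteDuality
open Summit.BirchSwinnertonDyer.Rank1Residual.X11b.Relaxation
open Summit.BirchSwinnertonDyer.Rank1Residual.X11b.LocBridge
open Summit.BirchSwinnertonDyer.Rank1Residual.X11b
open Summit.BirchSwinnertonDyer.Rank1Residual.GaloisImage
open Summit.BirchSwinnertonDyer.Rank1Residual.X11b.Three.Koly.ZhangSupply
open Summit.BirchSwinnertonDyer.Rank1Residual.X11b.KummerPT

namespace Summit.BirchSwinnertonDyer.BirchSwinnertonDyer.Theorems.AdditiveKoly.LagrangianSwitchAtP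

variable {K : Type} [Field K] [NumberField K] (W : WeierstrassCurve K) [W.IsElliptic]

/-! ## §5 THE ONE-PLACE SWITCH for a base structure Kummer off `U`, Lagrangian on `U`, at a place `w₀ ∉ U` -/

section Switch

variable (p : ℕ) [Fact p.Prime]
variable (e : W.geomTorsion ((p ^ 1 : ℕ) : ℤ) → W.geomTorsion ((p ^ 1 : ℕ) : ℤ) → AlgebraicClosure K)
  (hμ : ∀ S T, e S T ^ (p ^ 1) = 1)
  (hadd₁ : ∀ S₁ S₂ T, e (S₁ + S₂) T = e S₁ T * e S₂ T)
  (hadd₂ : ∀ S T₁ T₂, e S (T₁ + T₂) = e S T₁ * e S T₂)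
  (hgal : ∀ (σ : absoluteGaloisGroup K) (S T : W.geomTorsion ((p ^ 1 : ℕ) : ℤ)), σ • e S T = e (σ • S) (σ • T))
  (halt : ∀ T, e T T = 1) (hnondeg : ∀ T, (∀ S, e S T = 1) → T = 0)
  (inv : LocalInvariants K (p ^ 1))

include halt hnondeg in
/-- **THE ONE-PLACE LAGRANGIAN SWITCH FOR A GENERAL BASE.** As `natCard_selmerGroup_switch`, but the base structure `𝓑` is E's Kummer structure
`𝓚` only off a finite set `U` of finite places, and LAGRANGIAN at the places of `U` (e.g. `𝓑 = 𝓚[w₁ ↦ L₁]` after a first switch); the switched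
place `w₀ ∉ U` is a PLANE (`#H¹(K_{w₀}, E[p]) = p²`) and the new condition `L` there is isotropic, non-zero and `≠ 𝓚_{w₀}`. Then
`#H¹_𝓑 = p · #H¹_{𝓑[w₀ ↦ L]}` OR `#H¹_{𝓑[w₀ ↦ L]} = p · #H¹_𝓑`. Proof verbatim the base-`𝓚` one with the jump `relIndex_update_bot_top_sq_of_base`
and the reciprocity `invWeilPairing_localization_eq_zero_of_mem_update_top` (the conditions of `𝓑` off `w₀` are isotropic: Lagrangian on `U`,
Kummer elsewhere). This is what makes switches COMPOSABLE (two places above a split `p`).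
[cite: PoonenRains2012, Prop. 4.10, Prop. 4.11] [cite: MilneADT2006, Ch. I, Cor. 2.3, Thm. 2.8, Thm. 4.10] -/
theorem natCard_selmerGroup_switch_of_base
    [∀ v : Place K, CompactSpace (absoluteGaloisGroup (Place.Completion v))] [Finite (W.geomTorsion ((p ^ 1 : ℕ) : ℤ))]
    (hp2 : p ≠ 2) (hperf : inv.IsPerfect) (hsum : inv.SumLocalTermEqZero) (hcompl : inv.SelmerComplement)
    (𝓑 : SelmerStructure (W.torsionGaloisModule ((p ^ 1 : ℕ) : ℤ))) (U : Finset (HeightOneSpectrum (𝓞 K)))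
    (h𝓑K : ∀ v : Place K, (∀ u ∈ U, v ≠ Sum.inr u) → 𝓑 v = W.kummerSelmerStructure ((p ^ 1 : ℕ) : ℤ) v)
    (h𝓑lag : ∀ u ∈ U, annRight (invWeilPairing W (p ^ 1) e hμ hadd₁ hadd₂ hgal inv (Sum.inr u)) (𝓑 (Sum.inr u)) =
      𝓑 (Sum.inr u))
    (w₀ : HeightOneSpectrum (𝓞 K)) (hw₀ : w₀ ∉ U)
    (hH : Nat.card (galoisCohomology ((W.torsionGaloisModule ((p ^ 1 : ℕ) : ℤ)).toLocal (Sum.inr w₀ : Place K)) 1) = p ^ 2)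
    (L : AddSubgroup (galoisCohomology ((W.torsionGaloisModule ((p ^ 1 : ℕ) : ℤ)).toLocal (Sum.inr w₀ : Place K)) 1))
    (hLiso : ∀ x ∈ L, ∀ y ∈ L, invWeilPairing W (p ^ 1) e hμ hadd₁ hadd₂ hgal inv (Sum.inr w₀) x y = 0)
    (hL0 : L ≠ ⊥) (hLK : L ≠ W.kummerSelmerStructure ((p ^ 1 : ℕ) : ℤ) (Sum.inr w₀)) :
    Nat.card 𝓑.selmerGroup =
        p * Nat.card (SelmerStructure.selmerGroup (Function.update 𝓑 (Sum.inr w₀ : Place K) L)) ∨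
      Nat.card (SelmerStructure.selmerGroup (Function.update 𝓑 (Sum.inr w₀ : Place K) L)) =
        p * Nat.card 𝓑.selmerGroup := by
  have hp : p.Prime := Fact.out
  haveI : NeZero (p ^ 1 : ℕ) := ⟨pow_ne_zero 1 hp.ne_zero⟩
  have hp1 : IsPrimePow (p ^ 1 : ℕ) := hp.isPrimePow.pow one_ne_zero
  have hodd : Odd (p ^ 1 : ℕ) := (hp.odd_of_ne_two hp2).pow
  haveI hfinH : Finite (galoisCohomology ((W.torsionGaloisModule ((p ^ 1 : ℕ) : ℤ)).toLocal (Sum.inr w₀ : Place K)) 1) :=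
    Nat.finite_of_card_ne_zero (by rw [hH]; exact pow_ne_zero 2 hp.ne_zero)
  have hA : ∀ x : galoisCohomology ((W.torsionGaloisModule ((p ^ 1 : ℕ) : ℤ)).toLocal (Sum.inr w₀ : Place K)) 1,
      (p ^ 1) • x = 0 :=
    nsmul_continuousCohomology_one_eq_zero _ (p ^ 1)
      (fun T : W.geomTorsion ((p ^ 1 : ℕ) : ℤ) ↦ AddSubgroup.torsionBy.nsmul T)
  -- the base condition at `w₀` is E's Kummer condition
  have h𝓑w₀ : 𝓑 (Sum.inr w₀) = W.kummerSelmerStructure ((p ^ 1 : ℕ) : ℤ) (Sum.inr w₀) :=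
    h𝓑K _ fun u hu h ↦ hw₀ (by rw [Sum.inr_injective h]; exact hu)
  -- the pairing at `w₀`: symmetric, non-degenerate
  have hsymm : ∀ x y, invWeilPairing W (p ^ 1) e hμ hadd₁ hadd₂ hgal inv (Sum.inr w₀) x y =
      invWeilPairing W (p ^ 1) e hμ hadd₁ hadd₂ hgal inv (Sum.inr w₀) y x :=
    fun x y ↦ invWeilPairing_symm W (p ^ 1) e hμ hadd₁ hadd₂ hgal halt inv _ x y
  have hbij : Bijective (invWeilPairing W (p ^ 1) e hμ hadd₁ hadd₂ hgal inv (Sum.inr w₀)) :=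
    invWeilPairing_bijective W (p ^ 1) e hμ hadd₁ hadd₂ hgal hnondeg inv w₀ (hperf w₀).1.1
  have hnd : ∀ x, (∀ y, invWeilPairing W (p ^ 1) e hμ hadd₁ hadd₂ hgal inv (Sum.inr w₀) x y = 0) → x = 0 :=
    fun x hx ↦ hbij.1 ((AddMonoidHom.ext hx).trans (map_zero _).symm)
  have hflip : Bijective (invWeilPairing W (p ^ 1) e hμ hadd₁ hadd₂ hgal inv (Sum.inr w₀)).flip := by
    have h : (invWeilPairing W (p ^ 1) e hμ hadd₁ hadd₂ hgal inv (Sum.inr w₀)).flip =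
        invWeilPairing W (p ^ 1) e hμ hadd₁ hadd₂ hgal inv (Sum.inr w₀) := by
      ext x y
      exact hsymm y x
    rw [h]
    exact hbij
  -- the two auxiliary structures
  set 𝓕 : SelmerStructure (W.torsionGaloisModule ((p ^ 1 : ℕ) : ℤ)) :=
    Function.update 𝓑 (Sum.inr w₀ : Place K) (⊥ : AddSubgroup _) with h𝓕
  set 𝓖 : SelmerStructure (W.torsionGaloisModule ((p ^ 1 : ℕ) : ℤ)) :=
    Function.update 𝓑 (Sum.inr w₀ : Place K) ⊤ with h𝓖
  -- (1) the JUMP `[relaxed : strict] = p`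
  have hle : 𝓕.selmerGroup ≤ 𝓖.selmerGroup := selmerGroup_update_bot_le_of_base W (p ^ 1) 𝓑 _
  have hidx : 𝓕.selmerGroup.relIndex 𝓖.selmerGroup = p := by
    have h := relIndex_update_bot_top_sq_of_base W p e hμ hadd₁ hadd₂ hgal halt hnondeg inv hp2 hperf hsum hcompl 𝓑 U
      h𝓑K h𝓑lag w₀
    rw [hH] at h
    exact Nat.pow_left_injective two_ne_zero h
  have hcardGF : Nat.card 𝓕.selmerGroup * p = Nat.card 𝓖.selmerGroup := by
    have h : Nat.card 𝓕.selmerGroup * 𝓕.selmerGroup.relIndex 𝓖.selmerGroup = Nat.card 𝓖.selmerGroup := by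
      rw [← Nat.card_congr (AddSubgroup.addSubgroupOfEquivOfLe hle).toEquiv]
      exact AddSubgroup.card_mul_index _
    rwa [hidx] at h
  -- (2) the image `Λ` at `w₀` of the relaxed group: order `p`, isotropic
  have hFG : 𝓕.selmerGroup = 𝓖.selmerGroup ⊓
      (galoisCohomology.localization (W.torsionGaloisModule ((p ^ 1 : ℕ) : ℤ)) (Sum.inr w₀ : Place K) 1).ker :=
    selmerGroup_update_bot_eq_of_base W (p ^ 1) 𝓑 _
  have hΛcard : Nat.card (𝓖.selmerGroup.map
      (galoisCohomology.localization (W.torsionGaloisModule ((p ^ 1 : ℕ) : ℤ)) (Sum.inr w₀ : Place K) 1)) = p := by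
    rw [natCard_map_eq_relIndex, ← hFG, hidx]
  have h𝓑iso : ∀ v : Place K, v ≠ Sum.inr w₀ → ∀ a ∈ 𝓑 v, ∀ b ∈ 𝓑 v,
      invWeilPairing W (p ^ 1) e hμ hadd₁ hadd₂ hgal inv v a b = 0 := by
    intro v hv a ha b hb
    by_cases hvU : ∃ u ∈ U, v = Sum.inr u
    · obtain ⟨u, hu, rfl⟩ := hvU
      exact ((h𝓑lag u hu).symm.le hb) a ha
    · push Not at hvU
      rw [h𝓑K v hvU] at ha hb
      exact invWeilPairing_eq_zero_of_mem W (p ^ 1) e hμ hadd₁ hadd₂ hgal halt inv v ha hb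
  have hΛiso : ∀ x ∈ 𝓖.selmerGroup.map
      (galoisCohomology.localization (W.torsionGaloisModule ((p ^ 1 : ℕ) : ℤ)) (Sum.inr w₀ : Place K) 1),
      ∀ y ∈ 𝓖.selmerGroup.map
      (galoisCohomology.localization (W.torsionGaloisModule ((p ^ 1 : ℕ) : ℤ)) (Sum.inr w₀ : Place K) 1),
      invWeilPairing W (p ^ 1) e hμ hadd₁ hadd₂ hgal inv (Sum.inr w₀) x y = 0 := by
    rintro _ ⟨x, hx, rfl⟩ _ ⟨y, hy, rfl⟩
    exact invWeilPairing_localization_eq_zero_of_mem_update_top W (p ^ 1) e hμ hadd₁ hadd₂ hgal inv hsum 𝓑 _ h𝓑iso hx hy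
  -- (3) the two given lines have order `p`
  have hKiso : ∀ x ∈ W.kummerSelmerStructure ((p ^ 1 : ℕ) : ℤ) (Sum.inr w₀),
      ∀ y ∈ W.kummerSelmerStructure ((p ^ 1 : ℕ) : ℤ) (Sum.inr w₀),
      invWeilPairing W (p ^ 1) e hμ hadd₁ hadd₂ hgal inv (Sum.inr w₀) x y = 0 := fun x hx y hy ↦
    invWeilPairing_eq_zero_of_mem W (p ^ 1) e hμ hadd₁ hadd₂ hgal halt inv _ hx hy
  have hKcard : Nat.card (W.kummerSelmerStructure ((p ^ 1 : ℕ) : ℤ) (Sum.inr w₀)) = p := by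
    have h := natCard_annRight_mul hA _ hflip (W.kummerSelmerStructure ((p ^ 1 : ℕ) : ℤ) (Sum.inr w₀))
    rw [annRight_kummer_eq_of_odd W (p ^ 1) e hμ hadd₁ hadd₂ hgal halt hnondeg inv hp1 hodd hperf _, hH] at h
    have h' : Nat.card (W.kummerSelmerStructure ((p ^ 1 : ℕ) : ℤ) (Sum.inr w₀)) ^ 2 = p ^ 2 := by
      rw [sq]; exact h
    exact Nat.pow_left_injective two_ne_zero h'
  have hLcard : Nat.card L = p :=
    (natCard_eq_and_annRight_eq_of_isotropic W p e hμ hadd₁ hadd₂ hgal halt hnondeg inv hperf w₀ hH L hLiso hL0).1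
  -- (4) two isotropic lines carry every isotropic line: `Λ = 𝓚_{w₀}` or `Λ = L`
  haveI : Fact (p ^ 1).Prime := ⟨by rw [pow_one]; exact hp⟩
  have hHq : Nat.card (galoisCohomology ((W.torsionGaloisModule ((p ^ 1 : ℕ) : ℤ)).toLocal (Sum.inr w₀ : Place K)) 1) =
      (p ^ 1) ^ 2 := hH.trans (by rw [pow_one])
  have hcases := eq_or_eq_of_isotropic_of_card_eq (by rw [pow_one]; exact hp2) hHq _ hsymm hnd
    (hΛcard.trans (pow_one p).symm) (hKcard.trans (pow_one p).symm) (hLcard.trans (pow_one p).symm)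
    hΛiso hKiso hLiso hLK.symm
  -- (5) the two Selmer groups as cuts of the relaxed group
  have hSelK : 𝓑.selmerGroup = 𝓖.selmerGroup ⊓
      (W.kummerSelmerStructure ((p ^ 1 : ℕ) : ℤ) (Sum.inr w₀)).comap
        (galoisCohomology.localization (W.torsionGaloisModule ((p ^ 1 : ℕ) : ℤ)) (Sum.inr w₀ : Place K) 1) := by
    have h := selmerGroup_update_eq_of_base W (p ^ 1) 𝓑 (Sum.inr w₀ : Place K) (𝓑 (Sum.inr w₀))
    rwa [Function.update_eq_self, h𝓑w₀] at h
  have hSelL := selmerGroup_update_eq_of_base W (p ^ 1) 𝓑 (Sum.inr w₀ : Place K) L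
  have hKL : ∀ z, z ∈ W.kummerSelmerStructure ((p ^ 1 : ℕ) : ℤ) (Sum.inr w₀) → z ∈ L → z = 0 := fun z hzK hzL ↦ by
    by_contra hz
    exact hLK ((zmultiples_eq_of_card_eq_prime L hLcard hzL hz).symm.trans
      (zmultiples_eq_of_card_eq_prime _ hKcard hzK hz))
  rcases hcases with hΛ | hΛ
  · left
    rw [hSelK, hSelL, inf_comap_eq_self_of_map_eq _ _ hΛ, inf_comap_eq_inf_ker_of_map_eq _ _ hΛ hKL, ← hFG,
      ← hcardGF, Nat.mul_comm]
  · right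
    rw [hSelK, hSelL, inf_comap_eq_self_of_map_eq _ _ hΛ,
      inf_comap_eq_inf_ker_of_map_eq _ _ hΛ (fun z hzL hzK ↦ hKL z hzK hzL), ← hFG, ← hcardGF, Nat.mul_comm]

end Switch

/-! ## §6 The DOUBLE SWITCH at two plane places: the Selmer order moves by `p²`, `1` or `p⁻²` -/

section Double

variable (p : ℕ) [Fact p.Prime]

/-- **THE DOUBLE SWITCH.** `p ≠ 2`, the named Poitou–Tate fact (a THEOREM of the tree: `poitouTate_selmerStructure_duality_holds`), two DISTINCT
finite places `w₁ ≠ w₂` at which `H¹(K_{w_i}, E[p])` is a plane, and at each a local condition `L_i` isotropic (for every family ∕ Weil pairing),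
non-zero and different from E's Kummer condition. Then for `N₀ = #H¹_𝓚` (E's `p`-Selmer group) and `N₂ = #H¹_{𝓚[w₁ ↦ L₁][w₂ ↦ L₂]}`:
`N₀ = p²·N₂` OR `N₀ = N₂` OR `N₂ = p²·N₀` — the two one-place switches (`natCard_selmerGroup_switch`, then `natCard_selmerGroup_switch_of_base`
with `U = {w₁}`, `L₁` being Lagrangian by `natCard_eq_and_annRight_eq_of_isotropic`) each move the order by exactly one factor `p`. In particular
the `𝔽_p`-dimensions of the two Selmer groups have the SAME PARITY (`exists_pow_and_even_iff_of_double_switch`). Over the Heegner field of the crux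
chain KS′ ∕ KPA′ with `p` split, `w₁ = 𝔭`, `w₂ = 𝔭̄`: the parity leg of the «FL-engine» (card `irred-vertex-anchor`, T2), modulo E's `p`-Selmer
parity. [cite: PoonenRains2012, Prop. 4.10, Prop. 4.11] [cite: MilneADT2006, Ch. I, Cor. 2.3, Thm. 2.8, Thm. 4.10] -/
theorem natCard_selmerGroup_double_switch_of_poitouTate (hp2 : p ≠ 2) (hPT : poitouTate_selmerStructure_duality K)
    (w₁ w₂ : HeightOneSpectrum (𝓞 K)) (hw : w₁ ≠ w₂)
    (hH₁ : Nat.card (galoisCohomology ((W.torsionGaloisModule ((p ^ 1 : ℕ) : ℤ)).toLocal (Sum.inr w₁ : Place K)) 1) = p ^ 2)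
    (hH₂ : Nat.card (galoisCohomology ((W.torsionGaloisModule ((p ^ 1 : ℕ) : ℤ)).toLocal (Sum.inr w₂ : Place K)) 1) = p ^ 2)
    (L₁ : AddSubgroup (galoisCohomology ((W.torsionGaloisModule ((p ^ 1 : ℕ) : ℤ)).toLocal (Sum.inr w₁ : Place K)) 1))
    (L₂ : AddSubgroup (galoisCohomology ((W.torsionGaloisModule ((p ^ 1 : ℕ) : ℤ)).toLocal (Sum.inr w₂ : Place K)) 1))
    (hL₁iso : ∀ [∀ v : Place K, CompactSpace (absoluteGaloisGroup (Place.Completion v))]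
      (inv : LocalInvariants K (p ^ 1))
      (e : W.geomTorsion ((p ^ 1 : ℕ) : ℤ) → W.geomTorsion ((p ^ 1 : ℕ) : ℤ) → AlgebraicClosure K)
      (hμ : ∀ S T, e S T ^ (p ^ 1) = 1) (hadd₁ : ∀ S₁ S₂ T, e (S₁ + S₂) T = e S₁ T * e S₂ T)
      (hadd₂ : ∀ S T₁ T₂, e S (T₁ + T₂) = e S T₁ * e S T₂)
      (hgal : ∀ (σ : absoluteGaloisGroup K) (S T : W.geomTorsion ((p ^ 1 : ℕ) : ℤ)), σ • e S T = e (σ • S) (σ • T)),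
      inv.IsPerfect → (∀ T, e T T = 1) → (∀ T, (∀ S, e S T = 1) → T = 0) →
      ∀ x ∈ L₁, ∀ y ∈ L₁, invWeilPairing W (p ^ 1) e hμ hadd₁ hadd₂ hgal inv (Sum.inr w₁) x y = 0)
    (hL₂iso : ∀ [∀ v : Place K, CompactSpace (absoluteGaloisGroup (Place.Completion v))]
      (inv : LocalInvariants K (p ^ 1))
      (e : W.geomTorsion ((p ^ 1 : ℕ) : ℤ) → W.geomTorsion ((p ^ 1 : ℕ) : ℤ) → AlgebraicClosure K)
      (hμ : ∀ S T, e S T ^ (p ^ 1) = 1) (hadd₁ : ∀ S₁ S₂ T, e (S₁ + S₂) T = e S₁ T * e S₂ T)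
      (hadd₂ : ∀ S T₁ T₂, e S (T₁ + T₂) = e S T₁ * e S T₂)
      (hgal : ∀ (σ : absoluteGaloisGroup K) (S T : W.geomTorsion ((p ^ 1 : ℕ) : ℤ)), σ • e S T = e (σ • S) (σ • T)),
      inv.IsPerfect → (∀ T, e T T = 1) → (∀ T, (∀ S, e S T = 1) → T = 0) →
      ∀ x ∈ L₂, ∀ y ∈ L₂, invWeilPairing W (p ^ 1) e hμ hadd₁ hadd₂ hgal inv (Sum.inr w₂) x y = 0)
    (hL₁0 : L₁ ≠ ⊥) (hL₂0 : L₂ ≠ ⊥) (hL₁K : L₁ ≠ W.kummerSelmerStructure ((p ^ 1 : ℕ) : ℤ) (Sum.inr w₁))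
    (hL₂K : L₂ ≠ W.kummerSelmerStructure ((p ^ 1 : ℕ) : ℤ) (Sum.inr w₂)) :
    Nat.card (W.kummerSelmerStructure ((p ^ 1 : ℕ) : ℤ)).selmerGroup =
        p ^ 2 * Nat.card (SelmerStructure.selmerGroup (Function.update
          (Function.update (W.kummerSelmerStructure ((p ^ 1 : ℕ) : ℤ)) (Sum.inr w₁ : Place K) L₁ :
            SelmerStructure (W.torsionGaloisModule ((p ^ 1 : ℕ) : ℤ))) (Sum.inr w₂ : Place K) L₂)) ∨
      Nat.card (W.kummerSelmerStructure ((p ^ 1 : ℕ) : ℤ)).selmerGroup =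
        Nat.card (SelmerStructure.selmerGroup (Function.update
          (Function.update (W.kummerSelmerStructure ((p ^ 1 : ℕ) : ℤ)) (Sum.inr w₁ : Place K) L₁ :
            SelmerStructure (W.torsionGaloisModule ((p ^ 1 : ℕ) : ℤ))) (Sum.inr w₂ : Place K) L₂)) ∨
      Nat.card (SelmerStructure.selmerGroup (Function.update
          (Function.update (W.kummerSelmerStructure ((p ^ 1 : ℕ) : ℤ)) (Sum.inr w₁ : Place K) L₁ :
            SelmerStructure (W.torsionGaloisModule ((p ^ 1 : ℕ) : ℤ))) (Sum.inr w₂ : Place K) L₂)) =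
        p ^ 2 * Nat.card (W.kummerSelmerStructure ((p ^ 1 : ℕ) : ℤ)).selmerGroup := by
  have hp : p.Prime := Fact.out
  haveI : NeZero (p ^ 1 : ℕ) := ⟨pow_ne_zero 1 hp.ne_zero⟩
  haveI : PerfectField K := PerfectField.ofCharZero
  haveI : ∀ v : Place K, CompactSpace (absoluteGaloisGroup (Place.Completion v)) := fun v ↦
    absoluteGaloisGroup_compactSpace _
  haveI : Finite (W.geomTorsion ((p ^ 1 : ℕ) : ℤ)) := finite_geomTorsion_of_neZero W (p ^ 1)
  obtain ⟨e, hμ, hadd₁, hadd₂, halt, hnondeg, hgal⟩ :=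
    exists_weilPairing_holds W (p ^ 1) (by rw [pow_one]; exact hp.two_le) (by exact_mod_cast pow_ne_zero 1 hp.ne_zero)
  obtain ⟨inv, hperf, hsum, -, hcompl⟩ := hPT (p ^ 1)
  set 𝓚 : SelmerStructure (W.torsionGaloisModule ((p ^ 1 : ℕ) : ℤ)) := W.kummerSelmerStructure ((p ^ 1 : ℕ) : ℤ) with h𝓚
  set 𝓑 : SelmerStructure (W.torsionGaloisModule ((p ^ 1 : ℕ) : ℤ)) := Function.update 𝓚 (Sum.inr w₁ : Place K) L₁ with h𝓑
  -- first switch, base `𝓚`, at `w₁`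
  have h1 := natCard_selmerGroup_switch W p e hμ hadd₁ hadd₂ hgal halt hnondeg inv hp2 hperf hsum hcompl w₁ hH₁ L₁
    (hL₁iso inv e hμ hadd₁ hadd₂ hgal hperf halt hnondeg) hL₁0 hL₁K
  -- second switch, base `𝓑 = 𝓚[w₁ ↦ L₁]` (Kummer off `{w₁}`, Lagrangian at `w₁`), at `w₂ ∉ {w₁}`
  have h𝓑K : ∀ v : Place K, (∀ u ∈ ({w₁} : Finset (HeightOneSpectrum (𝓞 K))), v ≠ Sum.inr u) →
      𝓑 v = W.kummerSelmerStructure ((p ^ 1 : ℕ) : ℤ) v := fun v hv ↦ by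
    rw [h𝓑, Function.update_of_ne (hv w₁ (Finset.mem_singleton_self _))]
  have h𝓑lag : ∀ u ∈ ({w₁} : Finset (HeightOneSpectrum (𝓞 K))),
      annRight (invWeilPairing W (p ^ 1) e hμ hadd₁ hadd₂ hgal inv (Sum.inr u)) (𝓑 (Sum.inr u)) = 𝓑 (Sum.inr u) := by
    intro u hu
    rw [Finset.mem_singleton] at hu
    subst hu
    rw [h𝓑, Function.update_self]
    exact (natCard_eq_and_annRight_eq_of_isotropic W p e hμ hadd₁ hadd₂ hgal halt hnondeg inv hperf u hH₁ L₁
      (hL₁iso inv e hμ hadd₁ hadd₂ hgal hperf halt hnondeg) hL₁0).2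
  have hw₂ : w₂ ∉ ({w₁} : Finset (HeightOneSpectrum (𝓞 K))) := fun h ↦ hw (Finset.mem_singleton.mp h).symm
  have h2 := natCard_selmerGroup_switch_of_base W p e hμ hadd₁ hadd₂ hgal halt hnondeg inv hp2 hperf hsum hcompl 𝓑 {w₁}
    h𝓑K h𝓑lag w₂ hw₂ hH₂ L₂ (hL₂iso inv e hμ hadd₁ hadd₂ hgal hperf halt hnondeg) hL₂0 hL₂K
  -- combine
  rcases h1 with h1 | h1 <;> rcases h2 with h2 | h2
  · left
    rw [h1, h2, ← mul_assoc, sq]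
  · right; left
    rw [h1, h2]
  · right; left
    have h : p * Nat.card 𝓚.selmerGroup = p * Nat.card (SelmerStructure.selmerGroup
        (Function.update 𝓑 (Sum.inr w₂ : Place K) L₂)) := by rw [← h1, h2]
    exact Nat.eq_of_mul_eq_mul_left hp.pos h
  · right; right
    rw [h2, h1, ← mul_assoc, sq]

/-- **Parity form of the double switch**: if E's `p`-Selmer group has order `p^a`, the doubly switched Selmer group has order `p^b` with
`a ≡ b (mod 2)`. (Arithmetic on `natCard_selmerGroup_double_switch_of_poitouTate`.) [folklore] -/
theorem exists_pow_and_even_iff_of_double_switch {N₀ N₂ : ℕ} (h : N₀ = p ^ 2 * N₂ ∨ N₀ = N₂ ∨ N₂ = p ^ 2 * N₀) {a : ℕ}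
    (ha : N₀ = p ^ a) : ∃ b : ℕ, N₂ = p ^ b ∧ (Even a ↔ Even b) := by
  have hp : p.Prime := Fact.out
  rcases h with h | h | h
  · -- `p^a = p² N₂`
    have hdvd : N₂ ∣ p ^ a := ⟨p ^ 2, by rw [← ha, h, mul_comm]⟩
    obtain ⟨i, -, hi⟩ := (Nat.dvd_prime_pow hp).mp hdvd
    refine ⟨i, hi, ?_⟩
    have hai : a = i + 2 := by
      apply Nat.pow_right_injective hp.two_le
      simp only
      rw [← ha, h, hi, ← pow_add, add_comm]
    rw [hai, Nat.even_add]
    simp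
  · exact ⟨a, h ▸ ha, Iff.rfl⟩
  · refine ⟨a + 2, by rw [h, ha, ← pow_add, add_comm], ?_⟩
    rw [Nat.even_add]
    simp

end Double

end Summit.BirchSwinnertonDyer.BirchSwinnertonDyer.Theorems.AdditiveKoly.LagrangianSwitchAtP

end
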